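import Literature.Barriers.QuantumAdvantage.UncorrectedNoiseMachineLaw
import HarnessLib

/-!
# Bremner–Montanaro–Shepherd 2017, Theorem 4 — the discharge

`bremnerMontanaroShepherd2017_thm4_holds : bremnerMontanaroShepherd2017_thm4`
(`Literature/Barriers/QuantumAdvantage/UncorrectedNoise.lean`), assembled from the support files

* `UncorrectedNoiseFourier` (noise operator, truncation estimate, prefix sums),
* `UncorrectedNoiseIQP` (IQP amplitudes and the `{Z, CZ, T}` wire-product formula for `p̂(S)`),
* `UncorrectedNoiseSampling` (the sequential sampler `Alg`, Lemma 10, rounding, coin counting),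
* `UncorrectedNoiseCoefficients` (the stored integers `coefInt` and their accuracy `3·2^{−P}|p̂(S)|`),
* `UncorrectedNoiseMachineTuples/Subsets/Gates/Coef/Sample/Run/Law` (the simulating machine in
  the `FP`-brick algebra, its polynomial running time and its exact output law).

Proof (§3 of the paper, with the error budget fixed): `ρ = 1 − 2η ∈ [0,1)`, `δ₀ = min δ 1`;
precision `P` with `9α'/4^P ≤ δ₀²/512`, degree `ℓ` with `α' ρ^{2(ℓ+1)} ≤ δ₀²/512`
(`α' = max α 1`), coin surplus `m₀` with `2^{m₀} ≥ 4/δ₀`. Then on every input: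
`‖q' − p̃‖₁ ≤ δ₀/16` (`l1_sq_qApprox_sub_noiseOp_le`: truncation estimate + coefficient accuracy +
Parseval + anti-concentration), Lemma 10 gives `‖Alg[q'] − p̃‖₁ ≤ δ₀/2`, the dyadic rounding of
the coins costs `2N/2^{N+m₀} ≤ δ₀/2`, so the total variation distance is `≤ δ₀/2 ≤ δ/2`; the
sampler is PPT by `sampler_isPPT`. The coefficient table is computed exactly (wire-product
formula) where the paper samples the coefficients by Chernoff bounds; the statement proved is the
one vendored in `UncorrectedNoise.lean`.

## References

* [BremnerMontanaroShepherd2017] M. J. Bremner, A. Montanaro, D. J. Shepherd, *Achieving quantum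
  supremacy with sparse and noisy commuting quantum computations*, Quantum 1 (2017) 8
  (arXiv:1610.01808): Thm 4 (p. 5), §3 (pp. 12–13), Lemmas 10–12 (App., p. 18).
-/

namespace Literature.Barriers.QuantumAdvantage

open scoped NNReal ENNReal
open scoped Matrix
open Finset _root_.Computability Literature.Computability.Complexity Literature.Computability.Cryptography
open Literature.Computability.Complexity.LowDegree (cubeFourierCoeff)
open NoisyIQPMachine

/-! ### The input state, the kernel and the collision mass in cube coordinates -/

/-- The padded input register is the machine's `zOfInput`. [folklore] -/
theorem padInput_get_eq_zOfInput (x : List Bool) (a : ℕ) :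
    padInput x.get a = zOfInput (x.length + a) x := by
  funext i
  unfold zOfInput
  by_cases h : (i : ℕ) < x.length
  · have hi : i = Fin.castAdd a ⟨i, h⟩ := Fin.ext rfl
    rw [hi, padInput, Fin.append_left, List.getD_eq_getElem?_getD, Fin.val_castAdd,
      List.getElem?_eq_getElem h]
    simp [List.get_eq_getElem]
  · have hle : x.length ≤ (i : ℕ) := not_lt.1 h
    have hi : i = Fin.natAdd x.length ⟨i - x.length, by omega⟩ := Fin.ext (by simp; omega)
    rw [hi, padInput, Fin.append_right, List.getD_eq_getElem?_getD, Fin.val_natAdd,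
      List.getElem?_eq_none (by simp)]
    rfl

/-- The kernel of an IQP family in cube coordinates. [folklore] -/
theorem kernel_apply_eq (F : IQPFamily) (x : List Bool) :
    F.kernel x = (bornPMF (iqpUnitary (F.diag x.length) *ᵥ
      basisState (zOfInput (width F x.length) x))).map List.ofFn := by
  show (bornPMF (iqpUnitary (F.diag x.length) *ᵥ basisState (padInput x.get (F.ancillas x.length)))).map List.ofFn = _
  rw [padInput_get_eq_zOfInput]

/-- **The noisy kernel in cube coordinates**: bit-flip noise after `List.ofFn` is the cube noise
kernel before it. [cite: BremnerMontanaroShepherd2017, §1 (p̃ = noisy p)] -/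
theorem kernel_withBitFlips_apply_eq (F : IQPFamily) (η : ℝ≥0) (hη : η ≤ 1) (x : List Bool) :
    (F.kernel.withBitFlips η hη) x = ((bornPMF (iqpUnitary (F.diag x.length) *ᵥ
      basisState (zOfInput (width F x.length) x))).bind (noisePMF η hη)).map List.ofFn := by
  show (F.kernel x).bind (flipBits η hη) = _
  rw [kernel_apply_eq, map_ofFn_bind_flipBits]

/-- **The collision mass is the cube `ℓ₂²` mass** of the IQP output probabilities.
[cite: BremnerMontanaroShepherd2017, Thm 4 (Σₓ pₓ²)] -/
theorem collisionMass_kernel_eq (F : IQPFamily) (x : List Bool) :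
    collisionMass (F.kernel x) (width F x.length) =
      ∑ w : QReg (width F x.length), iqpProb (F.diag x.length) (zOfInput (width F x.length) x) w ^ 2 := by
  rw [collisionMass, kernel_apply_eq]
  rw [← Equiv.sum_comp (Equiv.vectorEquivFin Bool (width F x.length)).symm]
  refine Finset.sum_congr rfl fun w _ => ?_
  have hlist : ((Equiv.vectorEquivFin Bool (width F x.length)).symm w).toList = List.ofFn w := by
    simp [Equiv.vectorEquivFin]
  rw [hlist, Literature.Computability.QuantumComplexity.pmf_map_apply_of_injective _ List.ofFn_injective,
    toReal_bornPMF_iqp_apply]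

/-- Masses of a `PMF` on the cube sum to one (as reals). [folklore] -/
theorem sum_toReal_pmf_eq_one {N : ℕ} (ν : PMF (Fin N → Bool)) : ∑ w, (ν w).toReal = 1 := by
  have h := PMF.tsum_coe ν
  rw [tsum_fintype] at h
  rw [← ENNReal.toReal_sum (fun w _ => PMF.apply_ne_top ν w), h, ENNReal.toReal_one]

/-! ### The approximation error of the machine's `q'` (§3.1) -/

section Approx

variable {N : ℕ}

/-- **`‖q' − p̃‖₁² ≤ α (9/4^P + ρ^{2(ℓ+1)})`**: the truncation estimate with the machine's
coefficients (accuracy `3·2^{−P}|p̂(S)|`, Parseval, anti-concentration `2^N Σ p² ≤ α`).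
[cite: BremnerMontanaroShepherd2017, §3.1 (displays 1–2 with γ, α)] -/
theorem l1_sq_qApprox_sub_noiseOp_le (D : QCircuit iqpDiag N) (x : List Bool) (ℓ P : ℕ) {ρ α : ℝ}
    (hρ0 : 0 ≤ ρ) (hρ1 : ρ ≤ 1)
    (hα : 2 ^ N * ∑ w, iqpProb D (zOfInput N x) w ^ 2 ≤ α) :
    (∑ w, |qApprox ℓ P (fun j => ⌊(2 : ℝ) ^ P * ρ ^ j⌋₊) ⌊(2 : ℝ) ^ P * Real.sqrt 2⌋₊ x D.gates w -
        noiseOp ((1 - ρ) / 2) (iqpProb D (zOfInput N x)) w|) ^ 2 ≤ α * (9 / 4 ^ P + (ρ ^ 2) ^ (ℓ + 1)) := by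
  set C : ℕ → ℕ := fun j => ⌊(2 : ℝ) ^ P * ρ ^ j⌋₊ with hC
  set R2 : ℕ := ⌊(2 : ℝ) ^ P * Real.sqrt 2⌋₊ with hR2
  set p := iqpProb D (zOfInput N x) with hp
  set s := ∑ w, p w ^ 2 with hs
  have hs0 : 0 ≤ s := Finset.sum_nonneg fun w _ => sq_nonneg _
  have hα0 : 0 ≤ α := le_trans (by positivity) hα
  have hη0 : (0 : ℝ) ≤ (1 - ρ) / 2 := by linarith
  have hη1 : (1 - ρ) / 2 ≤ (1 : ℝ) := by linarith
  have hρeq : 1 - 2 * ((1 - ρ) / 2) = ρ := by ring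
  have hcoef0 : ∀ S : Finset (Fin N), ℓ < S.card → coefFn ℓ P C R2 x D.gates S = 0 := fun S hS => by
    rw [coefFn, if_neg (not_le.2 hS)]
  have htr := truncation_l1_sq_le p hη0 hη1 ℓ (coefFn ℓ P C R2 x D.gates) hcoef0
  rw [hρeq] at htr
  refine (show (∑ w, |qApprox ℓ P C R2 x D.gates w - noiseOp ((1 - ρ) / 2) p w|) ^ 2 ≤ _ from htr).trans ?_
  -- coefficient accuracy on the small sets
  have hacc : ∀ S ∈ univ.filter (fun S : Finset (Fin N) => S.card ≤ ℓ),
      (coefFn ℓ P C R2 x D.gates S - ρ ^ S.card * cubeFourierCoeff p S) ^ 2 ≤ 9 / 4 ^ P * cubeFourierCoeff p S ^ 2 := by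
    intro S hS
    rw [Finset.mem_filter] at hS
    have h := abs_coefInt_div_sub_le D (zOfInput N x) S P hρ0 hρ1
    have hcS : coefFn ℓ P C R2 x D.gates S =
        (coefInt P C R2 D.gates (zOfInput N x) (indic S) : ℝ) / ((2 : ℝ) ^ N * 2 ^ N * (2 ^ P * 2 ^ P)) := by
      rw [coefFn, if_pos hS.2, scaleD]
    rw [hcS]
    have h4 : ((2 : ℝ) ^ P) ^ 2 = 4 ^ P := by rw [← pow_mul, mul_comm, pow_mul]; norm_num
    calc _ = |(coefInt P C R2 D.gates (zOfInput N x) (indic S) : ℝ) / ((2 : ℝ) ^ N * 2 ^ N * (2 ^ P * 2 ^ P)) -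
          ρ ^ S.card * cubeFourierCoeff p S| ^ 2 := (sq_abs _).symm
      _ ≤ (3 / 2 ^ P * |cubeFourierCoeff p S|) ^ 2 := pow_le_pow_left₀ (abs_nonneg _) h 2
      _ = 9 / 4 ^ P * cubeFourierCoeff p S ^ 2 := by rw [mul_pow, div_pow, sq_abs, h4]; norm_num
  have hpars : ∑ S : Finset (Fin N), cubeFourierCoeff p S ^ 2 = s / 2 ^ N :=
    Literature.Computability.Complexity.LowDegree.sum_cubeFourierCoeff_sq p
  have hsmall : ∑ S ∈ univ.filter (fun S : Finset (Fin N) => S.card ≤ ℓ),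
      (coefFn ℓ P C R2 x D.gates S - ρ ^ S.card * cubeFourierCoeff p S) ^ 2 ≤ 9 / 4 ^ P * (s / 2 ^ N) := by
    refine (Finset.sum_le_sum hacc).trans ?_
    rw [← Finset.mul_sum, ← hpars]
    refine mul_le_mul_of_nonneg_left (Finset.sum_le_sum_of_subset_of_nonneg (Finset.filter_subset _ _)
      fun S _ _ => sq_nonneg _) (by positivity)
  have h2N : (2 : ℝ) ^ (2 * N) = 2 ^ N * 2 ^ N := by rw [two_mul, pow_add]
  have hpow : (0 : ℝ) < 2 ^ N := by positivity
  calc 2 ^ (2 * N) * ∑ S ∈ univ.filter (fun S : Finset (Fin N) => S.card ≤ ℓ),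
          (coefFn ℓ P C R2 x D.gates S - ρ ^ S.card * cubeFourierCoeff p S) ^ 2 + (ρ ^ 2) ^ (ℓ + 1) * 2 ^ N * s
      ≤ 2 ^ (2 * N) * (9 / 4 ^ P * (s / 2 ^ N)) + (ρ ^ 2) ^ (ℓ + 1) * 2 ^ N * s := by
        gcongr
    _ = (2 ^ N * s) * (9 / 4 ^ P + (ρ ^ 2) ^ (ℓ + 1)) := by rw [h2N]; field_simp
    _ ≤ α * (9 / 4 ^ P + (ρ ^ 2) ^ (ℓ + 1)) := by gcongr

end Approx

/-! ### Theorem 4 -/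

/-- Choice of the precision `P`. [folklore] -/
theorem exists_precision (a e : ℝ) (he : 0 < e) : ∃ P : ℕ, a * 9 / 4 ^ P ≤ e := by
  obtain ⟨P, hP⟩ := pow_unbounded_of_one_lt (a * 9 / e) (by norm_num : (1 : ℝ) < 4)
  refine ⟨P, ?_⟩
  have h4 : (0 : ℝ) < 4 ^ P := by positivity
  rw [div_le_iff₀ h4]
  rw [div_lt_iff₀ he] at hP
  linarith

/-- Choice of the degree `ℓ`. [folklore] -/
theorem exists_degree (a r e : ℝ) (hr0 : 0 ≤ r) (hr1 : r < 1) (he : 0 < e) : ∃ ℓ : ℕ, a * r ^ (ℓ + 1) ≤ e := by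
  rcases le_or_gt a 0 with ha | ha
  · exact ⟨0, le_trans (mul_nonpos_of_nonpos_of_nonneg ha (pow_nonneg hr0 _)) he.le⟩
  · obtain ⟨k, hk⟩ := exists_pow_lt_of_lt_one (div_pos he ha) hr1
    refine ⟨k, ?_⟩
    have : r ^ (k + 1) ≤ r ^ k := pow_le_pow_of_le_one hr0 hr1.le (Nat.le_succ k)
    rw [lt_div_iff₀ ha] at hk
    nlinarith

/-- Choice of the coin surplus `m₀`. [folklore] -/
theorem exists_coins (b : ℝ) : ∃ m₀ : ℕ, b ≤ 2 ^ m₀ := by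
  obtain ⟨m₀, hm⟩ := pow_unbounded_of_one_lt b (by norm_num : (1 : ℝ) < 2)
  exact ⟨m₀, hm.le⟩

/-- **Bremner–Montanaro–Shepherd 2017, Theorem 4, discharged** for the tree's uniform IQP
families: the classical sampler of `UncorrectedNoiseMachineRun` (coefficient table by the exact
`{Z, CZ, T}` wire-product formula instead of the paper's Chernoff sampling; sequential sampler of
§3.2 with fair coins) is probabilistic polynomial-time and `δ`-close in `ℓ₁` to the noisy output
distribution on every input. [cite: BremnerMontanaroShepherd2017, Thm 4, §3 (proof), App. (Lemmas 10–12)] -/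
theorem bremnerMontanaroShepherd2017_thm4_holds : bremnerMontanaroShepherd2017_thm4 := by
  intro F α δ η hη hU hη0 hη12 hδ hcoll
  -- the damping factor `ρ = 1 − 2η ∈ [0, 1)`
  set ρ : ℝ := 1 - 2 * (η : ℝ) with hρ
  have hηpos : (0 : ℝ) < η := by exact_mod_cast hη0
  have hρ0 : 0 ≤ ρ := by rw [hρ]; linarith
  have hρ1 : ρ < 1 := by rw [hρ]; linarith
  have hρsq0 : 0 ≤ ρ ^ 2 := sq_nonneg _
  have hρsq1 : ρ ^ 2 < 1 := by nlinarith
  -- the target accuracy `δ₀ = min δ 1` and the constants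
  set δ₀ : ℝ := min δ 1 with hδ₀
  have hδ₀0 : 0 < δ₀ := lt_min hδ one_pos
  have hδ₀1 : δ₀ ≤ 1 := min_le_right _ _
  have hδ₀δ : δ₀ ≤ δ := min_le_left _ _
  set α' : ℝ := max α 1 with hα'
  have hα'1 : 1 ≤ α' := le_max_right _ _
  have he : 0 < δ₀ ^ 2 / 512 := by positivity
  obtain ⟨P, hP⟩ := exists_precision α' _ he
  obtain ⟨ℓ, hℓ⟩ := exists_degree α' (ρ ^ 2) _ hρsq0 hρsq1 he
  obtain ⟨m₀, hm₀⟩ := exists_coins (4 / δ₀)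
  set C : ℕ → ℕ := fun j => ⌊(2 : ℝ) ^ P * ρ ^ j⌋₊ with hC
  set R2 : ℕ := ⌊(2 : ℝ) ^ P * Real.sqrt 2⌋₊ with hR2
  refine ⟨sampler F ℓ P C R2 m₀, sampler_isPPT F ℓ P C R2 m₀ hU, fun x => ?_⟩
  -- one input: both laws are push-forwards under `List.ofFn` of laws on the cube
  rw [outputPMF_sampler, kernel_withBitFlips_apply_eq, tvDist_map_of_injective _ _ List.ofFn_injective,
    tvDist_eq_half_l1]
  set Nw := width F x.length with hNw
  set m := Nw + m₀ with hm
  set D := F.diag x.length with hD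
  set z : QReg Nw := zOfInput Nw x with hz
  set p : QReg Nw → ℝ := iqpProb D z with hp
  set μ : PMF (QReg Nw) := bornPMF (iqpUnitary D *ᵥ basisState z) with hμ
  set q' := qApprox ℓ P C R2 x D.gates with hq'
  -- the three probability vectors on the cube
  have hμp : ∀ w, (μ w).toReal = p w := fun w => toReal_bornPMF_iqp_apply D z w
  set pt : QReg Nw → ℝ := noiseOp (η : ℝ) p with hpt
  have hν : ∀ w, ((μ.bind (noisePMF η hη)) w).toReal = pt w := by
    intro w
    rw [toReal_bind_noisePMF_apply]
    simp only [hμp]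
    rfl
  have hpt0 : ∀ w, 0 ≤ pt w := fun w => by rw [← hν w]; exact ENNReal.toReal_nonneg
  have hpt1 : ∑ w, pt w = 1 := by simp_rw [← hν]; exact sum_toReal_pmf_eq_one _
  have halg : ∀ w, ((algPMF (roundingOK_roundUp m) Nw q') w).toReal = algR (roundUp m) Nw q' w :=
    fun w => toReal_algPMF_apply _ _ _ w
  have hgoal : ∑ w, |((algPMF (roundingOK_roundUp m) Nw q') w).toReal - ((μ.bind (noisePMF η hη)) w).toReal| =
      ∑ w, |algR (roundUp m) Nw q' w - pt w| := Finset.sum_congr rfl fun w _ => by rw [halg, hν]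
  rw [hgoal]
  -- (1) the approximation error `δ' = ‖q' − p̃‖₁ ≤ δ₀/16`
  have hcollx : 2 ^ Nw * ∑ w, p w ^ 2 ≤ α' := by
    have h := hcoll x
    rw [collisionMass_kernel_eq] at h
    have h2 : (0 : ℝ) < 2 ^ Nw := by positivity
    calc 2 ^ Nw * ∑ w, p w ^ 2 ≤ 2 ^ Nw * (α / 2 ^ Nw) := by gcongr
      _ = α := by field_simp
      _ ≤ α' := le_max_left _ _
  have hηρ : ((η : ℝ≥0) : ℝ) = (1 - ρ) / 2 := by rw [hρ]; ring
  have hsq := l1_sq_qApprox_sub_noiseOp_le D x ℓ P hρ0 hρ1.le hcollx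
  rw [← hηρ] at hsq
  set δ' : ℝ := ∑ w, |q' w - pt w| with hδ'
  have hδ'0 : 0 ≤ δ' := Finset.sum_nonneg fun w _ => abs_nonneg _
  have hδ'sq : δ' ^ 2 ≤ (δ₀ / 16) ^ 2 := by
    refine hsq.trans ?_
    have h1 : α' * (9 / 4 ^ P) ≤ δ₀ ^ 2 / 512 := by rw [← mul_div_assoc]; exact hP
    nlinarith
  have hδ'le : δ' ≤ δ₀ / 16 := (pow_le_pow_iff_left₀ hδ'0 (by positivity) two_ne_zero).1 hδ'sq
  -- (2) Lemma 10: `‖Alg[q'] − p̃‖₁ ≤ 4δ'/(1−δ') ≤ 8δ'`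
  have hδ'1 : δ' < 1 := by linarith
  have hL10 := l1_alg_sub_le pt q' hpt0 hpt1 (le_refl δ') hδ'1
  have hL10' : ∑ w, |algR id Nw q' w - pt w| ≤ δ₀ / 2 := by
    refine hL10.trans ?_
    rw [div_le_iff₀ (by linarith)]
    nlinarith
  -- (3) rounding: `‖Alg_R[q'] − Alg[q']‖₁ ≤ 2N/2^m ≤ δ₀/2`
  have hround := l1_algR_sub_alg_le (roundingOK_roundUp m) (fun t h0 h1 => abs_roundUp_sub_le m t h0 h1) Nw q'
  have hround' : ∑ w, |algR (roundUp m) Nw q' w - algR id Nw q' w| ≤ δ₀ / 2 := by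
    refine hround.trans ?_
    have hN : (Nw : ℝ) ≤ 2 ^ Nw := by exact_mod_cast (Nat.lt_two_pow_self).le
    have h2m : (2 : ℝ) ^ m = 2 ^ Nw * 2 ^ m₀ := by rw [hm, pow_add]
    have h2N : (0 : ℝ) < 2 ^ Nw := by positivity
    have h2m₀ : (0 : ℝ) < 2 ^ m₀ := by positivity
    have hm₀' : 4 ≤ δ₀ * 2 ^ m₀ := by rwa [div_le_iff₀ hδ₀0, mul_comm] at hm₀
    rw [h2m, mul_one_div, div_le_iff₀ (by positivity)]
    nlinarith [mul_le_mul_of_nonneg_right hN h2m₀.le]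
  -- total
  have htri : ∀ w, |algR (roundUp m) Nw q' w - pt w| ≤
      |algR (roundUp m) Nw q' w - algR id Nw q' w| + |algR id Nw q' w - pt w| := fun w => abs_sub_le _ _ _
  rw [show (2 : ℝ)⁻¹ = 1 / 2 by norm_num]
  calc 1 / 2 * ∑ w, |algR (roundUp m) Nw q' w - pt w|
      ≤ 1 / 2 * (∑ w, |algR (roundUp m) Nw q' w - algR id Nw q' w| + ∑ w, |algR id Nw q' w - pt w|) := by
        rw [← Finset.sum_add_distrib]; gcongr with w; exact htri w
    _ ≤ 1 / 2 * (δ₀ / 2 + δ₀ / 2) := by gcongr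
    _ ≤ δ / 2 := by linarith

end Literature.Barriers.QuantumAdvantage
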